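import Summits.HubbardSuperconductivity.HubbardSuperconductivity.Theorems.AnisotropyChordStiffnessFSum
import Summits.HubbardSuperconductivity.HubbardSuperconductivity.Theorems.AnisotropyChordStiffnessLorentz
import Summits.HubbardSuperconductivity.HubbardSuperconductivity.Theorems.AnisotropyChordInsertionEntropyGaussian

/-!
# Route `AnisotropyChord` / H0 rotor rung: THEOREM TWIST-IR, DIRECT FORM — the f-sum split by the Lorentz pair
# (theory seat memo ROTOR-THEORY-8 §118; Sketch8 Part N ported), with the stub T-FSUM DISCHARGED

For a Perron sector ground state `ψ` (energy `E`) and `k ≠ 0`, the LATTICE f-SUM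
`F(k) := Σᵢ |⟨vᵢ, D_k ψ⟩|²/(λᵢ − E) = Σ_j (1 − cos k_j) ⟨−T_j⟩` (stub `LatticeFSumRule` — **PROVED here**,
`latticeFSumRule_holds`, from `latticeFSum_eq`); split `1/ω = g_Ω(ω) + ℓ_Ω(ω)` (Lorentz pair,
`AnisotropyChordStiffnessLorentz`): the LOW part obeys `Σᵢ ℓ_Ω(ωᵢ)|Dᵢ|² ≤ (Ω/2)·P·S(k)` unconditionally
(`lowFilter_lemma`, `lowFilter_currentSpecWeight_le`), and THEOREM TWIST-IR's content is the HIGH part, stub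
`FilteredCurrentDeficit` (typed; the theory seat's).  Compositions (PROVED): `infraredStructureBound_of_fsum_deficit`,
`infraredStructureBound_of_twist_skeleton`, `eventualCondensate_of_twist_skeleton` — the cycle-8 final form of the
target: `LatticeFSumRule ∧ TwistFilteredDeficit ∧ (S_tw) ∧ H1′ ∧ (S ≤ S_max) ⇒ BEC`, and with T-FSUM discharged:
`eventualCondensate_of_twist_deficit` (one named stub left on the infrared side: `TwistFilteredDeficit`).
Typing authority: theory seat `hubbard-h0-rotor-theory-1`, cycle 8.
-/

set_option linter.dupNamespace false

noncomputable section

open Matrix Complex Finset Filter Topology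
open scoped ComplexConjugate
open Literature.MathematicalPhysics.QuantumLattice hiding torusPhase torusNorm
open Literature.Probability.LatticeModels
open Summit.HubbardSuperconductivity.HubbardSuperconductivity.Theorems.AnisotropyChord.InsertionEntropy

namespace Summit.HubbardSuperconductivity.HubbardSuperconductivity.Theorems.AnisotropyChord.Stiffness

/-! ## The low-filter lemma (abstract) -/

section AbstractLow

variable {n ι : Type*} [Fintype n] [DecidableEq ι]

/-- **LOW-FILTER LEMMA** (abstract): for orthonormal `H`-eigenpairs `(vᵢ, λᵢ)_{i∈s}`, any `E`, `Ω > 0`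
and any vector `x`:  `Σ_{i∈s} ℓ_Ω(λᵢ − E) |vᵢ†(Hx − Ex)|² ≤ (Ω/2) Σ_σ |x σ|²`
(`vᵢ†(Hx−Ex) = (λᵢ−E) vᵢ†x`, `ℓ_Ω(ω) ω² ≤ Ω/2` for every real `ω`, Bessel). [folklore] -/
theorem lowFilter_lemma (s : Finset ι) (H : Matrix n n ℂ) (hH : H.IsHermitian)
    (E : ℝ) (v : ι → n → ℂ) (hv : IsOrthonormalFamily v) (lam : ι → ℝ)
    (heig : ∀ i ∈ s, H *ᵥ v i = ((lam i : ℝ) : ℂ) • v i)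
    (Ω : ℝ) (hΩ : 0 < Ω) (x : n → ℂ) :
    ∑ i ∈ s, lorentzLow Ω (lam i - E) * ‖star (v i) ⬝ᵥ (H *ᵥ x - (E : ℂ) • x)‖ ^ 2
      ≤ Ω / 2 * ∑ σ, ‖x σ‖ ^ 2 := by
  have key : ∀ i ∈ s, star (v i) ⬝ᵥ (H *ᵥ x - (E : ℂ) • x)
      = ((lam i - E : ℝ) : ℂ) * (star (v i) ⬝ᵥ x) := by
    intro i hi
    have h1 : star (v i) ⬝ᵥ (H *ᵥ x) = ((lam i : ℝ) : ℂ) * (star (v i) ⬝ᵥ x) := by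
      rw [dotProduct_mulVec]
      have : star (v i) ᵥ* H = ((lam i : ℝ) : ℂ) • star (v i) := by
        have h2 : star (H *ᵥ v i) = star (v i) ᵥ* H := by
          rw [star_mulVec, hH.eq]
        rw [← h2, heig i hi, star_smul]
        simp
      rw [this, smul_dotProduct, smul_eq_mul]
    rw [dotProduct_sub, dotProduct_smul, h1, smul_eq_mul]
    push_cast
    ring
  have hll : ∀ ω : ℝ, lorentzLow Ω ω * ω ^ 2 ≤ Ω / 2 := by
    intro ω
    rcases lt_trichotomy ω 0 with hneg | hzero | hpos
    · have hl : lorentzLow Ω ω ≤ 0 := by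
        unfold lorentzLow
        apply div_nonpos_of_nonneg_of_nonpos (sq_nonneg Ω)
        nlinarith [sq_nonneg ω, sq_nonneg Ω]
      nlinarith [mul_nonpos_of_nonpos_of_nonneg hl (sq_nonneg ω)]
    · subst hzero
      simp [lorentzLow]
      positivity
    · exact lorentzLow_mul_sq_le hΩ hpos
  have hterm : ∀ i ∈ s, lorentzLow Ω (lam i - E) * ‖star (v i) ⬝ᵥ (H *ᵥ x - (E : ℂ) • x)‖ ^ 2
      ≤ Ω / 2 * ‖star (v i) ⬝ᵥ x‖ ^ 2 := by
    intro i hi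
    rw [key i hi, norm_mul, mul_pow, Complex.norm_real, Real.norm_eq_abs, sq_abs]
    have h0 : 0 ≤ ‖star (v i) ⬝ᵥ x‖ ^ 2 := by positivity
    calc lorentzLow Ω (lam i - E) * ((lam i - E) ^ 2 * ‖star (v i) ⬝ᵥ x‖ ^ 2)
        = (lorentzLow Ω (lam i - E) * (lam i - E) ^ 2) * ‖star (v i) ⬝ᵥ x‖ ^ 2 := by ring
      _ ≤ Ω / 2 * ‖star (v i) ⬝ᵥ x‖ ^ 2 := mul_le_mul_of_nonneg_right (hll _) h0
  calc ∑ i ∈ s, lorentzLow Ω (lam i - E) * ‖star (v i) ⬝ᵥ (H *ᵥ x - (E : ℂ) • x)‖ ^ 2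
      ≤ ∑ i ∈ s, Ω / 2 * ‖star (v i) ⬝ᵥ x‖ ^ 2 := Finset.sum_le_sum hterm
    _ = Ω / 2 * ∑ i ∈ s, ‖star (v i) ⬝ᵥ x‖ ^ 2 := by rw [Finset.mul_sum]
    _ ≤ Ω / 2 * ∑ σ, ‖x σ‖ ^ 2 :=
        mul_le_mul_of_nonneg_left (bessel_dotProduct s v hv x) (by positivity)


end AbstractLow

/-! ## The twist skeleton -/

section TwistSkeleton

/-- Hermiticity of the hard-core boson Hamiltonian (tree). [folklore] -/
theorem hcbHamiltonian_isHermitian (L : ℕ) [NeZero L] (Δ : ℝ) : (hcbHamiltonian L Δ).IsHermitian :=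
  xxzHamiltonian_isHermitian 1 (torusGraph 2 L) (-1) Δ

/-- The CURRENT SPECTRAL WEIGHT `|⟨vᵢ, D_k ψ⟩|²` of the eigenvector `vᵢ` of `H(Δ)` in the state
`ψ = a` (`D_k = [H, ρ_k]`). [folklore] -/
def currentSpecWeight (L : ℕ) [NeZero L] (Δ : ℝ) (a : TensorIndex (TorusSite 2 L) 2 → ℝ)
    (k : TorusSite 2 L) (i : TensorIndex (TorusSite 2 L) 2) : ℝ :=
  ‖star (⇑((hcbHamiltonian_isHermitian L Δ).eigenvectorBasis i)) ⬝ᵥ (currentDiv L Δ k *ᵥ toC L a)‖ ^ 2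

/-- Excitation energy `ωᵢ = λᵢ − E₀(M)` of the eigenvector `vᵢ` above the sector-`M` ground energy. [folklore] -/
def excitation (L : ℕ) [NeZero L] (Δ M : ℝ) (i : TensorIndex (TorusSite 2 L) 2) : ℝ :=
  (hcbHamiltonian_isHermitian L Δ).eigenvalues i - lowestEnergyInSector 1 (hcbHamiltonian L Δ) M

/-- The f-sum weight `1 − cos(2π k_j / L)` of lattice direction `j`. [folklore] -/
def fsumWeight (L : ℕ) [NeZero L] (k : TorusSite 2 L) (j : Fin 2) : ℝ :=
  1 - Real.cos (2 * Real.pi * ((k j).val : ℝ) / (L : ℝ))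

/-- Kinetic expectation `⟨ψ, (−T_j) ψ⟩` of direction `j` in the real state `a`. [folklore] -/
def kineticExpect (L : ℕ) [NeZero L] (a : TensorIndex (TorusSite 2 L) 2 → ℝ) (j : Fin 2) : ℝ :=
  (star (toC L a) ⬝ᵥ (kineticOp L j *ᵥ toC L a)).re

/-- **STUB T-FSUM — `LatticeFSumRule Δ`** (the lattice f-sum rule, exact): for `L ≥ 3`, every sector
ground amplitude `a` (sector `M`, energy `E`) and every `k`,
`Σᵢ |⟨vᵢ, D_k ψ⟩|²/(λᵢ − E) = Σ_j (1 − cos(2πk_j/L)) ⟨ψ, (−T_j) ψ⟩`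
(`= ⟨ρ_kψ, (H−E)ρ_kψ⟩ = ½⟨[ρ_k†,[H,ρ_k]]⟩`; the `SᶻSᶻ` term commutes with `ρ_k`; for `L ≥ 3` the directed
bonds `(x, x+e_j)` are the edges of the torus graph, cf. the `L = 2` double cover found by the prover
seat).  Terms with `λᵢ = E` vanish on both sides (`⟨vᵢ, D_kψ⟩ = (λᵢ−E)⟨vᵢ, ρ_kψ⟩`; `x/0 = 0`).
Size M: spin-operator algebra on the torus + `sum_dotProduct_smul_eigenvectorBasis`.
[conjecture: theory seat hubbard-h0-rotor-theory-1, cycle 8, 2026-08-28 — memo ROTOR-THEORY-8 §118 stub T-FSUM; PROVED below (`latticeFSumRule_holds`)] -/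
def LatticeFSumRule (Δ : ℝ) : Prop :=
  ∀ (L : ℕ) [NeZero L], 3 ≤ L → ∀ (M : ℝ) (a : TensorIndex (TorusSite 2 L) 2 → ℝ),
    IsPerronSectorGroundAmplitude L Δ M a → ∀ k : TorusSite 2 L,
      ∑ i, currentSpecWeight L Δ a k i / excitation L Δ M i
        = ∑ j : Fin 2, fsumWeight L k j * kineticExpect L a j

/-- **STUB T-DEFICIT — `FilteredCurrentDeficit Δ M`** (the content of THEOREM TWIST-IR, memo §107
L2–L4 with the Lorentzian cutoff of §116): there are `γ ∈ (0,1]`, `C, Υ₁ > 0` such that, eventually in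
`L`, for every Perron reference amplitude and every `k ≠ 0`, the HIGH-FREQUENCY (Lorentz-filtered at
`Ω = C|k|_T^γ`) part of the f-sum misses a stiffness fraction:
`Σᵢ g_Ω(λᵢ − E)|⟨vᵢ, D_kψ⟩|² ≤ Σ_j (1 − cos(2πk_j/L)) (⟨−T_j⟩ − Υ₁ L²)`.
Mechanism: `D_k = Σ_j (1 − e^{ik_j}) J^j_k` (continuity); the `g_Ω`-filtered current kernel
`K^Ω_{jj'}(k)` is (i) at `k = 0` at most the total `m₋₁(J_0) = (⟨−T⟩ − Υ^tw|Λ|)/2` (`g_Ω ≤ 1/ω`; the twist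
stiffness JUMP, hypothesis `UniformTwistStiffness`), (ii) Lipschitz in `k` at resolution `Ω/v_LR`
(filtered locality `filteredSpectral_identity_odd` + Lieb–Robinson far field + `NearFieldParseval` +
`DiamagneticGridBound`, all tree/prover-seat items), so for `Ω = C|k|^γ`, `γ < 2/3`, the defect is
`≤ Υ^tw/4`.  Why it might fail: the near-field count `k²R³` vs `R = λv/Ω` forces `γ < 2/3` (Parseval) —
any `γ > 0` suffices here; cross terms `K_{12}(0)` need the reflection symmetry of the Perron state.
[conjecture: theory seat hubbard-h0-rotor-theory-1, cycle 8, 2026-08-28 — memo ROTOR-THEORY-8 §107/§116/§118; claimed THEOREM given (S_tw), proof at memo level] -/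
def FilteredCurrentDeficit (Δ : ℝ) (M : ℕ → ℝ) : Prop :=
  ∃ γ : ℝ, 0 < γ ∧ γ ≤ 1 ∧ ∃ C > (0 : ℝ), ∃ Υ₁ > (0 : ℝ), ∀ᶠ L : ℕ in atTop, ∀ [NeZero L],
    ∀ aM : TensorIndex (TorusSite 2 L) 2 → ℝ,
      IsPerronSectorGroundAmplitude L Δ (M L - 1) aM →
        ∀ k : TorusSite 2 L, k ≠ 0 →
          ∑ i, lorentzFilter (C * torusNorm L k ^ γ) (excitation L Δ (M L - 1) i)
                * currentSpecWeight L Δ aM k i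
            ≤ ∑ j : Fin 2, fsumWeight L k j * (kineticExpect L aM j - Υ₁ * (L : ℝ) ^ 2)

/-- **THEOREM TWIST-IR, direct form (typed target for the prover seat):** uniform twist stiffness ⇒
the filtered current deficit.
[conjecture: theory seat hubbard-h0-rotor-theory-1, cycle 8, 2026-08-28 — memo ROTOR-THEORY-8 §118 target TWIST-IR (direct form)] -/
def TwistFilteredDeficit : Prop :=
  ∀ (Δ : ℝ) (M : ℕ → ℝ), -1 < Δ → UniformTwistStiffness Δ M → FilteredCurrentDeficit Δ M

/-- `1 − cos(2π k_j/L) ≥ 8 m_j²/L²` summed: `(2/π²)|k|_T² ≤ Σ_j (1 − cos(2πk_j/L))`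
(reduce `k_j` to `m_j = min(k_j, L − k_j) ≤ L/2`, `1 − cos 2x = 2 sin² x`, Jordan `sin x ≥ (2/π)x`). [folklore] -/
theorem torusNorm_sq_le_fsumWeight_sum (L : ℕ) [NeZero L] (k : TorusSite 2 L) :
    2 / Real.pi ^ 2 * torusNorm L k ^ 2 ≤ ∑ j, fsumWeight L k j := by
  have hL : (0 : ℝ) < (L : ℝ) := by exact_mod_cast Nat.pos_of_ne_zero (NeZero.ne L)
  have hπ := Real.pi_pos
  -- per direction
  have hdir : ∀ j : Fin 2,
      8 * ((min (k j).val (L - (k j).val) : ℕ) : ℝ) ^ 2 / (L : ℝ) ^ 2 ≤ fsumWeight L k j := by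
    intro j
    set m : ℕ := min (k j).val (L - (k j).val) with hm
    have hval : (k j).val < L := ZMod.val_lt (k j)
    -- `cos (2π k_j/L) = cos (2π m/L)`
    have hcos : Real.cos (2 * Real.pi * ((k j).val : ℝ) / (L : ℝ))
        = Real.cos (2 * Real.pi * (m : ℝ) / (L : ℝ)) := by
      rcases Nat.le_total (k j).val (L - (k j).val) with h | h
      · rw [hm, min_eq_left h]
      · rw [hm, min_eq_right h, Nat.cast_sub hval.le]
        have : 2 * Real.pi * (((L : ℕ) : ℝ) - ((k j).val : ℝ)) / (L : ℝ)
            = -(2 * Real.pi * ((k j).val : ℝ) / (L : ℝ) - 2 * Real.pi) := by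
          field_simp
          ring
        rw [this, Real.cos_neg, Real.cos_sub_two_pi]
    -- `m ≤ L/2`
    have hmle : 2 * (m : ℝ) ≤ (L : ℝ) := by
      have h2 : 2 * m ≤ L := by
        rcases Nat.le_total (k j).val (L - (k j).val) with h | h
        · rw [hm, min_eq_left h]; omega
        · rw [hm, min_eq_right h]; omega
      exact_mod_cast h2
    have hx0 : 0 ≤ Real.pi * (m : ℝ) / (L : ℝ) := by positivity
    have hx1 : Real.pi * (m : ℝ) / (L : ℝ) ≤ Real.pi / 2 := by
      rw [div_le_div_iff₀ hL two_pos]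
      nlinarith
    have hjordan := Real.mul_le_sin hx0 hx1
    -- `1 − cos 2x = 2 sin² x`
    have hid : fsumWeight L k j = 2 * Real.sin (Real.pi * (m : ℝ) / (L : ℝ)) ^ 2 := by
      unfold fsumWeight
      rw [hcos, show 2 * Real.pi * (m : ℝ) / (L : ℝ) = 2 * (Real.pi * (m : ℝ) / (L : ℝ)) by ring,
        Real.cos_two_mul, Real.cos_sq']
      ring
    rw [hid]
    have hj : 2 * (m : ℝ) / (L : ℝ) ≤ Real.sin (Real.pi * (m : ℝ) / (L : ℝ)) := by
      have : 2 / Real.pi * (Real.pi * (m : ℝ) / (L : ℝ)) = 2 * (m : ℝ) / (L : ℝ) := by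
        field_simp
      rw [← this]; exact hjordan
    have h0 : 0 ≤ 2 * (m : ℝ) / (L : ℝ) := by positivity
    have hsq := pow_le_pow_left₀ h0 hj 2
    have : 8 * (m : ℝ) ^ 2 / (L : ℝ) ^ 2 = 2 * (2 * (m : ℝ) / (L : ℝ)) ^ 2 := by
      field_simp; ring
    rw [this]
    linarith
  -- sum
  have hnorm : 2 / Real.pi ^ 2 * torusNorm L k ^ 2
      = ∑ j, 8 * ((min (k j).val (L - (k j).val) : ℕ) : ℝ) ^ 2 / (L : ℝ) ^ 2 := by
    unfold torusNorm
    rw [mul_pow, div_pow, Real.sq_sqrt (Finset.sum_nonneg fun j _ => sq_nonneg _), Finset.mul_sum,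
      Finset.mul_sum]
    refine Finset.sum_congr rfl fun j _ => ?_
    field_simp
    ring
  rw [hnorm]
  exact Finset.sum_le_sum fun j _ => hdir j

/-- **The low-filter lemma in the model:** `Σᵢ ℓ_Ω(ωᵢ) |⟨vᵢ, D_kψ⟩|² ≤ (Ω/2)·P·S_a(k)` for every real
eigen-amplitude `a` of sector energy `E₀(M)`, every `k`, `Ω > 0`, `P ≠ 0`. (PROVED: `lowFilter_lemma` over the
full eigenvector basis + `currentDiv_mulVec_eigen` + `‖ρ_k a‖² = P S`.) [folklore] -/
theorem lowFilter_currentSpecWeight_le (L : ℕ) [NeZero L] (Δ M : ℝ)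
    (a : TensorIndex (TorusSite 2 L) 2 → ℝ) (ha : IsPerronSectorGroundAmplitude L Δ M a)
    (k : TorusSite 2 L) (Ω : ℝ) (hΩ : 0 < Ω) (P : ℝ) (hP : P ≠ 0) :
    ∑ i, lorentzLow Ω (excitation L Δ M i) * currentSpecWeight L Δ a k i
      ≤ Ω / 2 * (P * structureFactor L a P k) := by
  have hH := hcbHamiltonian_isHermitian L Δ
  have hv : IsOrthonormalFamily (fun i => ⇑((hcbHamiltonian_isHermitian L Δ).eigenvectorBasis i)) :=
    fun i j => star_eigenvectorBasis_dotProduct _ i j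
  have heig : ∀ i ∈ (Finset.univ : Finset (TensorIndex (TorusSite 2 L) 2)),
      hcbHamiltonian L Δ *ᵥ ⇑((hcbHamiltonian_isHermitian L Δ).eigenvectorBasis i)
        = (((hcbHamiltonian_isHermitian L Δ).eigenvalues i : ℝ) : ℂ)
            • ⇑((hcbHamiltonian_isHermitian L Δ).eigenvectorBasis i) := by
    intro i _
    rw [(hcbHamiltonian_isHermitian L Δ).mulVec_eigenvectorBasis i]
    funext σ
    simp only [Pi.smul_apply, Complex.real_smul, smul_eq_mul]
  have h := lowFilter_lemma Finset.univ (hcbHamiltonian L Δ) (hcbHamiltonian_isHermitian L Δ)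
    (lowestEnergyInSector 1 (hcbHamiltonian L Δ) M) _ hv _ heig Ω hΩ (densityModeOp L k *ᵥ toC L a)
  rw [mul_comm P, ← sum_norm_sq_densityMode_mulVec a hP k]
  have hD : currentDiv L Δ k *ᵥ toC L a
      = hcbHamiltonian L Δ *ᵥ (densityModeOp L k *ᵥ toC L a)
        - ((lowestEnergyInSector 1 (hcbHamiltonian L Δ) M : ℝ) : ℂ) • (densityModeOp L k *ᵥ toC L a) :=
    comm_mulVec_eigen _ _ _ _ ha.eigen
  unfold currentSpecWeight excitation
  simp_rw [hD]
  exact h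

/-- **COMPOSITION (PROVED): f-sum rule ∧ filtered current deficit ⇒ (IR_{2−γ}).**  With the density
normalisation `0 < P_L ≤ L²` eventually (`P_L = L²/2 + M_L − 1`), the two stubs give the tree's
`InfraredStructureBound Δ M` with `α = 2 − γ` and `c = 4Υ₁/(π² C)`. [folklore] -/
theorem infraredStructureBound_of_fsum_deficit (Δ : ℝ) (M : ℕ → ℝ)
    (hF : LatticeFSumRule Δ) (hD : FilteredCurrentDeficit Δ M)
    (hP : ∀ᶠ L : ℕ in atTop, ∀ [NeZero L],
      0 < (L : ℝ) ^ 2 / 2 + (M L - 1) ∧ (L : ℝ) ^ 2 / 2 + (M L - 1) ≤ (L : ℝ) ^ 2) :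
    InfraredStructureBound Δ M := by
  obtain ⟨γ, hγ, hγ1, C, hC, Υ₁, hΥ, hev⟩ := hD
  refine ⟨4 * Υ₁ / (Real.pi ^ 2 * C), by positivity, 2 - γ, by linarith, ?_⟩
  filter_upwards [hev, hP, eventually_ge_atTop 3] with L hDL hPL h3L
  intro _ aM haM k hk
  obtain ⟨hP0, hPle⟩ := hPL
  have hL : (0 : ℝ) < (L : ℝ) ^ 2 := by
    have : (0 : ℝ) < (L : ℝ) := by exact_mod_cast Nat.pos_of_ne_zero (NeZero.ne L)
    positivity
  have ht : 0 < torusNorm L k := torusNorm_pos hk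
  have htγ : 0 < torusNorm L k ^ γ := Real.rpow_pos_of_pos ht γ
  have hΩ : 0 < C * torusNorm L k ^ γ := mul_pos hC htγ
  -- the three inputs
  have hFL := hF L h3L (M L - 1) aM haM k
  have hDk := hDL aM haM k hk
  have hlow := lowFilter_currentSpecWeight_le L Δ (M L - 1) aM haM k _ hΩ _ hP0.ne'
  -- termwise split `w/ω = g w + ℓ w`
  have hsplit : ∑ i, currentSpecWeight L Δ aM k i / excitation L Δ (M L - 1) i
      = ∑ i, lorentzFilter (C * torusNorm L k ^ γ) (excitation L Δ (M L - 1) i)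
            * currentSpecWeight L Δ aM k i
        + ∑ i, lorentzLow (C * torusNorm L k ^ γ) (excitation L Δ (M L - 1) i)
            * currentSpecWeight L Δ aM k i := by
    rw [← Finset.sum_add_distrib]
    refine Finset.sum_congr rfl fun i _ => ?_
    by_cases he : excitation L Δ (M L - 1) i = 0
    · simp [he, lorentzFilter, lorentzLow]
    · rw [← add_mul, ← inv_eq_lorentzFilter_add_low he hΩ.ne']
      ring
  -- the weight lower bound
  have hκ := torusNorm_sq_le_fsumWeight_sum L k
  have hS0 : 0 ≤ structureFactor L aM ((L : ℝ) ^ 2 / 2 + (M L - 1)) k :=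
    structureFactor_nonneg aM hP0.le k
  have hsum : ∑ j : Fin 2, fsumWeight L k j * (kineticExpect L aM j - Υ₁ * (L : ℝ) ^ 2)
      = ∑ j : Fin 2, fsumWeight L k j * kineticExpect L aM j
          - Υ₁ * (L : ℝ) ^ 2 * ∑ j : Fin 2, fsumWeight L k j := by
    rw [Finset.mul_sum, ← Finset.sum_sub_distrib]
    refine Finset.sum_congr rfl fun j _ => ?_
    ring
  -- `Υ₁ L² Σκ ≤ (Ω/2) P S ≤ (Ω/2) L² S`
  have h1 : Υ₁ * (L : ℝ) ^ 2 * ∑ j : Fin 2, fsumWeight L k j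
      ≤ C * torusNorm L k ^ γ / 2
          * (((L : ℝ) ^ 2 / 2 + (M L - 1)) * structureFactor L aM ((L : ℝ) ^ 2 / 2 + (M L - 1)) k) := by
    linarith [hFL, hDk, hlow, hsplit, hsum]
  have h2 : ((L : ℝ) ^ 2 / 2 + (M L - 1)) * structureFactor L aM ((L : ℝ) ^ 2 / 2 + (M L - 1)) k
      ≤ (L : ℝ) ^ 2 * structureFactor L aM ((L : ℝ) ^ 2 / 2 + (M L - 1)) k :=
    mul_le_mul_of_nonneg_right hPle hS0
  have h1' : Υ₁ * (L : ℝ) ^ 2 * ∑ j : Fin 2, fsumWeight L k j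
      ≤ C * torusNorm L k ^ γ / 2 * ((L : ℝ) ^ 2 * structureFactor L aM ((L : ℝ) ^ 2 / 2 + (M L - 1)) k) :=
    h1.trans (mul_le_mul_of_nonneg_left h2 (by positivity))
  -- `2 |k|² ≤ π² Σκ`, `|k|² = |k|^{2−γ} |k|^γ`
  have hπ : (0 : ℝ) < Real.pi ^ 2 := by positivity
  have hκ' : 2 * (torusNorm L k ^ (2 - γ) * torusNorm L k ^ γ) ≤ Real.pi ^ 2 * ∑ j : Fin 2, fsumWeight L k j := by
    have h := hκ
    rw [div_mul_eq_mul_div, div_le_iff₀ hπ, ← Real.rpow_two, show (2 : ℝ) = (2 - γ) + γ by ring,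
      Real.rpow_add ht] at h
    linarith
  have e1 := mul_le_mul_of_nonneg_left hκ' (by positivity : (0 : ℝ) ≤ 2 * Υ₁ * (L : ℝ) ^ 2)
  have e2 := mul_le_mul_of_nonneg_left h1' (by positivity : (0 : ℝ) ≤ 2 * Real.pi ^ 2)
  have hfin : 4 * Υ₁ * torusNorm L k ^ (2 - γ) * ((L : ℝ) ^ 2 * torusNorm L k ^ γ)
      ≤ Real.pi ^ 2 * C * structureFactor L aM ((L : ℝ) ^ 2 / 2 + (M L - 1)) k
          * ((L : ℝ) ^ 2 * torusNorm L k ^ γ) := by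
    linarith [e1, e2]
  have hcancel := le_of_mul_le_mul_right hfin (by positivity)
  rw [div_mul_eq_mul_div, div_le_iff₀ (by positivity)]
  linarith [hcancel]

/-- **THEOREM TWIST-IR assembled in direct form:** f-sum rule + (twist stiffness ⇒ filtered deficit)
⇒ ((S_tw) ⇒ (IR_α)). [folklore] -/
theorem infraredStructureBound_of_twist_skeleton (Δ : ℝ) (M : ℕ → ℝ) (hΔ : -1 < Δ)
    (hF : LatticeFSumRule Δ) (hT : TwistFilteredDeficit)
    (hP : ∀ᶠ L : ℕ in atTop, ∀ [NeZero L],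
      0 < (L : ℝ) ^ 2 / 2 + (M L - 1) ∧ (L : ℝ) ^ 2 / 2 + (M L - 1) ≤ (L : ℝ) ^ 2)
    (hS : UniformTwistStiffness Δ M) : InfraredStructureBound Δ M :=
  infraredStructureBound_of_fsum_deficit Δ M hF (hT Δ M hΔ hS) hP

/-- **THE TARGET, cycle-8 final form (PROVED modulo the two named stubs and H1′):** along a density
sequence `→ ρ ∈ (0,1)` with non-trivial sectors, `LatticeFSumRule` ∧ `TwistFilteredDeficit` (= THEOREM
TWIST-IR) ∧ uniform twist stiffness ∧ Gaussian-comparable insertion entropy ∧ no Bragg peak ⇒ BEC. [folklore] -/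
theorem eventualCondensate_of_twist_skeleton (Δ : ℝ) (M : ℕ → ℝ) (ρ : ℝ) (hΔ : -1 < Δ)
    (hρ : ρ ∈ Set.Ioo (0 : ℝ) 1)
    (hlim : Tendsto (fun L : ℕ => 1 / 2 + M L / (L : ℝ) ^ 2) atTop (𝓝 ρ))
    (hsect : ∀ᶠ L : ℕ in atTop, ∀ [NeZero L], spinZSector (Λ := TorusSite 2 L) 1 (M L - 1) ≠ ⊥)
    (hF : LatticeFSumRule Δ) (hT : TwistFilteredDeficit)
    (hG : GaussianInsertionComparison Δ M) (hS : UniformTwistStiffness Δ M)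
    (hSmax : StructureFactorUpper Δ M) : EventualCondensate Δ M := by
  have hρ0 : 0 < ρ := hρ.1
  have hρ1 : ρ < 1 := hρ.2
  have hlimM := tendsto_density_pred M ρ hlim
  have hMlo : ∀ᶠ L : ℕ in atTop, ρ / 2 ≤ 1 / 2 + (M L - 1) / (L : ℝ) ^ 2 :=
    hlimM.eventually (eventually_ge_nhds (by linarith))
  have hMhi : ∀ᶠ L : ℕ in atTop, 1 / 2 + (M L - 1) / (L : ℝ) ^ 2 ≤ (1 + ρ) / 2 :=
    hlimM.eventually (eventually_le_nhds (by linarith))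
  have hP : ∀ᶠ L : ℕ in atTop, ∀ [NeZero L],
      0 < (L : ℝ) ^ 2 / 2 + (M L - 1) ∧ (L : ℝ) ^ 2 / 2 + (M L - 1) ≤ (L : ℝ) ^ 2 := by
    filter_upwards [hMlo, hMhi] with L hlo hhi
    intro _
    have hL' : (L : ℝ) ≠ 0 := by exact_mod_cast (NeZero.ne L)
    have hL : (0 : ℝ) < (L : ℝ) ^ 2 := by positivity
    have hPM : (L : ℝ) ^ 2 / 2 + (M L - 1) = (L : ℝ) ^ 2 * (1 / 2 + (M L - 1) / (L : ℝ) ^ 2) := by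
      field_simp
    rw [hPM]
    constructor
    · have : 0 < 1 / 2 + (M L - 1) / (L : ℝ) ^ 2 := lt_of_lt_of_le (by linarith) hlo
      positivity
    · have : 1 / 2 + (M L - 1) / (L : ℝ) ^ 2 ≤ 1 := hhi.trans (by linarith)
      nlinarith
  exact eventualCondensate_of_insertionEntropyBound Δ M ρ hρ hlim
    (insertionEntropyBound_of_gaussianComparison Δ M ρ hρ hlim hG
      (infraredStructureBound_of_twist_skeleton Δ M hΔ hF hT hP hS) hSmax)
    (uniformSiteDensity_holds Δ M) (perronSectorExists_of_ne_bot Δ M hsect)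


/-! ## T-FSUM discharged -/

/-- **`LatticeFSumRule Δ` HOLDS** for every anisotropy (stub T-FSUM of THEOREM TWIST-IR is a tree theorem,
`latticeFSum_eq` of `AnisotropyChordStiffnessFSum`). [folklore] -/
theorem latticeFSumRule_holds (Δ : ℝ) : LatticeFSumRule Δ := by
  intro L _ hL M a ha k
  unfold currentSpecWeight excitation fsumWeight kineticExpect
  exact latticeFSum_eq hL Δ a (lowestEnergyInSector 1 (hcbHamiltonian L Δ) M) ha.eigen k

/-- **The target with T-FSUM discharged:** along a density sequence `→ ρ ∈ (0,1)` with non-trivial sectors,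
`TwistFilteredDeficit` (= THEOREM TWIST-IR, the one remaining infrared stub) ∧ uniform twist stiffness ∧
Gaussian-comparable insertion entropy (H1′) ∧ no Bragg peak ⇒ BEC. [folklore] -/
theorem eventualCondensate_of_twist_deficit (Δ : ℝ) (M : ℕ → ℝ) (ρ : ℝ) (hΔ : -1 < Δ)
    (hρ : ρ ∈ Set.Ioo (0 : ℝ) 1)
    (hlim : Tendsto (fun L : ℕ => 1 / 2 + M L / (L : ℝ) ^ 2) atTop (𝓝 ρ))
    (hsect : ∀ᶠ L : ℕ in atTop, ∀ [NeZero L], spinZSector (Λ := TorusSite 2 L) 1 (M L - 1) ≠ ⊥)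
    (hT : TwistFilteredDeficit) (hG : GaussianInsertionComparison Δ M) (hS : UniformTwistStiffness Δ M)
    (hSmax : StructureFactorUpper Δ M) : EventualCondensate Δ M :=
  eventualCondensate_of_twist_skeleton Δ M ρ hΔ hρ hlim hsect (latticeFSumRule_holds Δ) hT hG hS hSmax

end TwistSkeleton

end Summit.HubbardSuperconductivity.HubbardSuperconductivity.Theorems.AnisotropyChord.Stiffness
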